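import Literature.NumberTheory.Sieve.LiouvilleSiftedClasses
import Literature.NumberTheory.LFunctions.SiegelWalfiszLiouville
import Literature.NumberTheory.Sieve.MoebiusShiftedPrimesTypical
import Literature.NumberTheory.Sieve.SieveFrameworkProofs
import HarnessLib

/-!
# Sifted sums of `λχ`: Lichtman's Lemma 4.8 from Siegel–Walfisz and the fundamental lemma

Topic `Literature/NumberTheory/Sieve`.  This file PROVES the named fact
`Literature.NumberTheory.Sieve.Lichtman2020_liouvilleCharacterSifted` (`MoebiusShiftedPrimesTypical.lean`;
J. D. Lichtman, *Averages of the Möbius function on shifted primes*, arXiv:2009.08969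
[Lichtman2020], Lemma 4.8, p. 12: for `A, K > 0`, `q ≤ (log x)^A`, `χ (mod q)`, and any set of primes
`𝒫 ⊂ (q, x^{1/log log x})`, `∑_{m ≤ x, (m,𝒟)=1} λ(m)χ(m) ≪_{A,K} x/(log x)^K`) from the tree's named
fact `Literature.NumberTheory.LFunctions.SiegelWalfiszMoebius` (Montgomery–Vaughan §11.3
Exercise 13(f); through `SiegelWalfiszMoebius.liouville_progression`, the Liouville version proved in
`SiegelWalfiszLiouville.lean`) and the Fundamental Lemma of sieve theory (proved in the tree,
`SieveSequence.fundamental_lemma_uniform_holds`, through `LiouvilleSifted.exists_sifted_sum_bound`):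

* `Lichtman2020_liouvilleCharacterSifted_of_siegelWalfiszMoebius :
    SiegelWalfiszMoebius → Lichtman2020_liouvilleCharacterSifted`.

## The argument (a variant of the printed proof, pp. 12–13)

The printed proof sieves `𝒜^{(b,ν)}` by all of `𝒫 ⊂ (q, z₀)`, `z₀ = x^{1/log log x}`, with linear sieve
weights of level `D = z₀^s`, `s = 2K log₂x/log₃x`, using the `β`-sieve error `O(s^{-s})`; the tree's
fundamental lemma has the error `O(e^{-s})`, which at this level saves no power of `log x`.  We
therefore split `𝒫 = 𝒫_s ∪ 𝒫_ℓ` at `z₁ = exp(L/(log L)²)` (`L = log x`):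
* the primes of `𝒫_ℓ ⊂ [z₁, z₀)` are removed by the exact Legendre identity
  `𝟙_{(m,𝒟_ℓ)=1} = ∑_{T ⊆ 𝒫_ℓ, ∏T ∣ m} (-1)^{|T|}` (`legendre_indicator`), so that
  `S₀ = ∑_{T ⊆ 𝒫_ℓ} (-1)^{|T|} λχ(d_T) · T_{⌊x⌋/d_T}`, `d_T = ∏_{p ∈ T} p`,
  `T_M = ∑_{n ≤ M, (n,𝒟_s)=1} λχ(n)` (`sifted_sum_decomposition`);
* for `d_T ≤ √x` the sieve half (`LiouvilleSifted.exists_sifted_sum_bound`, sifting by `𝒫_s` at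
  `z = z₁` with level `x^{1/4}`, so `s = (log L)²/4` and `e^{-s}` beats every power of `L`, the
  remainders by Siegel–Walfisz for `λ`) gives `|T_M| ≪ M L^{-K-1}`, and
  `∑_T 1/d_T = ∏_{p ∈ 𝒫_ℓ}(1 + 1/p) ≤ e^{c₀} log L` by Mertens over the window `[z₁, z₀)`
  (`sum_primesWindow_one_div_le`: `∑_{z₁ ≤ p < z₀} 1/p ≤ log log L + c₀`);
* for `d_T > √x`, trivially `|T_{⌊x⌋/d_T}| ≤ x/d_T`, and
  `∑_{d_T > √x} ⌊x/d_T⌋ = ∑_{m ≤ x} #{T ⊆ 𝒫_ℓ(m) : d_T > √x} ≤ ∑_{m ≤ x} 2^{ω_ℓ(m)} 𝟙[ω_ℓ(m) > ½ log L]`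
  (`ω_ℓ(m) = #{p ∈ 𝒫_ℓ : p ∣ m}`; a product of `k` primes `< z₀` exceeds `√x` only if
  `k > ½ log L`), which by the exponential moment
  `∑_{m ≤ x} Y^{ω_ℓ(m)} ≤ x ∏_{p ∈ 𝒫_ℓ}(1 + (Y-1)/p) ≤ x (e^{c₀} log L)^{Y-1}` (`moment_bound`) with
  `Y = 2e^{2K+2}` is `≪ x L^{-K-1} (log L)^{O_K(1)}` (Chernoff).

## References

* J. D. Lichtman, arXiv:2009.08969, Lemma 4.8, pp. 12–13. [Lichtman2020]
* H. L. Montgomery, R. C. Vaughan, *Multiplicative Number Theory I*, §11.3 Ex. 13(f).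
  [MontgomeryVaughan2007]
* J. Friedlander, H. Iwaniec, *Opera de Cribro*, Cor. 6.10. [FriedlanderIwaniecOpera2010]
-/

open Finset ArithmeticFunction Filter

noncomputable section

namespace Literature.NumberTheory.Sieve

namespace LiouvilleSifted

/-! ### Products over sets of primes and the Legendre identity -/

/-- `d_T = ∏_{p ∈ T} p`. [folklore] -/
def prodSet (T : Finset ℕ) : ℕ := ∏ p ∈ T, p

/-- `d_T ≥ 1` for a set of primes. [folklore] -/
theorem prodSet_pos {T : Finset ℕ} (hT : ∀ p ∈ T, p.Prime) : 0 < prodSet T :=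
  Finset.prod_pos fun p hp => (hT p hp).pos

/-- For a set `T` of primes: `d_T ∣ m` iff every `p ∈ T` divides `m`. [folklore] -/
theorem prodSet_dvd_iff {T : Finset ℕ} (hT : ∀ p ∈ T, p.Prime) (m : ℕ) :
    prodSet T ∣ m ↔ ∀ p ∈ T, p ∣ m := by
  constructor
  · intro h p hp
    exact (Finset.dvd_prod_of_mem _ hp).trans h
  · intro h
    exact Finset.prod_primes_dvd m (fun p hp => Nat.prime_iff.1 (hT p hp)) h

/-- A prime divides `d_T` iff it belongs to `T`. [folklore] -/
theorem prime_dvd_prodSet_iff {T : Finset ℕ} (hT : ∀ p ∈ T, p.Prime) {p : ℕ} (hp : p.Prime) :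
    p ∣ prodSet T ↔ p ∈ T := by
  unfold prodSet
  rw [(Nat.prime_iff.1 hp).dvd_finsetProd_iff]
  constructor
  · rintro ⟨r, hr, hpr⟩
    have : p = r := (Nat.prime_dvd_prime_iff_eq hp (hT r hr)).1 hpr
    subst this; exact hr
  · intro h; exact ⟨p, h, dvd_rfl⟩

/-- The subsets of `Pl` whose product divides `m` are the subsets of `{p ∈ Pl : p ∣ m}`. [folklore] -/
theorem filter_powerset_prodSet_dvd {Pl : Finset ℕ} (hPl : ∀ p ∈ Pl, p.Prime) (m : ℕ) :
    Pl.powerset.filter (fun T => prodSet T ∣ m) = (Pl.filter (· ∣ m)).powerset := by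
  ext T
  simp only [Finset.mem_filter, Finset.mem_powerset]
  constructor
  · rintro ⟨hT, hd⟩ p hp
    exact Finset.mem_filter.2 ⟨hT hp, (prodSet_dvd_iff (fun p hp => hPl p (hT hp)) m).1 hd p hp⟩
  · intro h
    have hT : T ⊆ Pl := fun p hp => (Finset.mem_filter.1 (h hp)).1
    exact ⟨hT, (prodSet_dvd_iff (fun p hp => hPl p (hT hp)) m).2 fun p hp => (Finset.mem_filter.1 (h hp)).2⟩

/-- **Legendre's identity over a set of primes**:
`𝟙[no p ∈ Pl divides m] = ∑_{T ⊆ Pl, d_T ∣ m} (-1)^{|T|}`. [folklore] -/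
theorem legendre_indicator {Pl : Finset ℕ} (hPl : ∀ p ∈ Pl, p.Prime) (m : ℕ) :
    (if ∀ p ∈ Pl, ¬ p ∣ m then (1 : ℂ) else 0) =
      ∑ T ∈ Pl.powerset, if prodSet T ∣ m then (-1 : ℂ) ^ #T else 0 := by
  rw [← Finset.sum_filter, filter_powerset_prodSet_dvd hPl]
  have h := congrArg (Int.cast : ℤ → ℂ) (Finset.sum_powerset_neg_one_pow_card (x := Pl.filter (· ∣ m)))
  push_cast at h
  rw [h]
  have hiff : (Pl.filter (· ∣ m) = ∅) ↔ ∀ p ∈ Pl, ¬ p ∣ m := by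
    simp only [Finset.filter_eq_empty_iff]
  by_cases hc : ∀ p ∈ Pl, ¬ p ∣ m
  · rw [if_pos hc, if_pos (hiff.2 hc)]
  · rw [if_neg hc, if_neg (fun h' => hc (hiff.1 h'))]

/-! ### The decomposition `S₀ = ∑_T (-1)^{|T|} ∑_{d_T ∣ m} …` -/

/-- Splitting the sifting condition: with `Ps = Pss ∪ Pl`,
`∑_{m ∈ s, (m, 𝒟) = 1} f = ∑_{T ⊆ Pl} (-1)^{|T|} ∑_{m ∈ s, (m, 𝒟_s)=1, d_T ∣ m} f`. [folklore] -/
theorem sifted_sum_decomposition {Ps Pss Pl : Finset ℕ} (hPl : ∀ p ∈ Pl, p.Prime)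
    (hunion : ∀ m : ℕ, (∀ p ∈ Ps, ¬ p ∣ m) ↔ (∀ p ∈ Pss, ¬ p ∣ m) ∧ ∀ p ∈ Pl, ¬ p ∣ m)
    (s : Finset ℕ) (f : ℕ → ℂ) :
    ∑ m ∈ s.filter (fun m : ℕ => ∀ p ∈ Ps, ¬ p ∣ m), f m =
      ∑ T ∈ Pl.powerset, (-1 : ℂ) ^ #T *
        ∑ m ∈ s.filter (fun m : ℕ => (∀ p ∈ Pss, ¬ p ∣ m) ∧ prodSet T ∣ m), f m := by
  calc ∑ m ∈ s.filter (fun m : ℕ => ∀ p ∈ Ps, ¬ p ∣ m), f m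
      = ∑ m ∈ s.filter (fun m : ℕ => ∀ p ∈ Pss, ¬ p ∣ m),
          (if ∀ p ∈ Pl, ¬ p ∣ m then (1 : ℂ) else 0) * f m := by
        rw [Finset.sum_filter, Finset.sum_filter]
        refine Finset.sum_congr rfl fun m _ => ?_
        by_cases h1 : ∀ p ∈ Pss, ¬ p ∣ m <;> by_cases h2 : ∀ p ∈ Pl, ¬ p ∣ m
        · rw [if_pos ((hunion m).2 ⟨h1, h2⟩), if_pos h1, if_pos h2, one_mul]
        · rw [if_neg (fun h => h2 ((hunion m).1 h).2), if_pos h1, if_neg h2, zero_mul]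
        · rw [if_neg (fun h => h1 ((hunion m).1 h).1), if_neg h1]
        · rw [if_neg (fun h => h1 ((hunion m).1 h).1), if_neg h1]
    _ = ∑ m ∈ s.filter (fun m : ℕ => ∀ p ∈ Pss, ¬ p ∣ m),
          ∑ T ∈ Pl.powerset, (if prodSet T ∣ m then (-1 : ℂ) ^ #T else 0) * f m := by
        refine Finset.sum_congr rfl fun m _ => ?_
        rw [legendre_indicator hPl m, Finset.sum_mul]
    _ = ∑ T ∈ Pl.powerset, ∑ m ∈ s.filter (fun m : ℕ => ∀ p ∈ Pss, ¬ p ∣ m),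
          (if prodSet T ∣ m then (-1 : ℂ) ^ #T else 0) * f m := Finset.sum_comm
    _ = _ := by
        refine Finset.sum_congr rfl fun T _ => ?_
        rw [Finset.mul_sum, Finset.sum_filter, Finset.sum_filter]
        refine Finset.sum_congr rfl fun m _ => ?_
        by_cases h1 : ∀ p ∈ Pss, ¬ p ∣ m <;> by_cases h2 : prodSet T ∣ m
        · rw [if_pos h1, if_pos h2, if_pos ⟨h1, h2⟩]
        · rw [if_pos h1, if_neg h2, if_neg (fun h => h2 h.2), zero_mul]
        · rw [if_neg h1, if_neg (fun h => h1 h.1)]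
        · rw [if_neg h1, if_neg (fun h => h1 h.1)]

/-- Reindexing the multiples of `d`: `∑_{0 < m ≤ N, d ∣ m, P(m)} f(m) = ∑_{0 < n ≤ N/d, P(dn)} f(dn)`. [folklore] -/
theorem sum_filter_dvd_eq {d : ℕ} (hd : 0 < d) (N : ℕ) (P : ℕ → Prop) [DecidablePred P] (f : ℕ → ℂ) :
    ∑ m ∈ (Ioc 0 N).filter (fun m : ℕ => P m ∧ d ∣ m), f m =
      ∑ n ∈ (Ioc 0 (N / d)).filter (fun n : ℕ => P (d * n)), f (d * n) := by
  refine Finset.sum_nbij' (fun m => m / d) (fun n => d * n) ?_ ?_ ?_ ?_ ?_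
  · intro m hm
    rw [Finset.mem_filter, Finset.mem_Ioc] at hm
    obtain ⟨⟨h1, h2⟩, hP, ⟨k, rfl⟩⟩ := hm
    rw [Finset.mem_filter, Finset.mem_Ioc, Nat.mul_div_cancel_left k hd]
    refine ⟨⟨?_, ?_⟩, hP⟩
    · rcases Nat.eq_zero_or_pos k with rfl | hk
      · simp at h1
      · exact hk
    · rw [Nat.le_div_iff_mul_le hd]; rw [mul_comm] at h2; exact h2
  · intro n hn
    rw [Finset.mem_filter, Finset.mem_Ioc] at hn
    obtain ⟨⟨h1, h2⟩, hP⟩ := hn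
    rw [Finset.mem_filter, Finset.mem_Ioc]
    refine ⟨⟨Nat.mul_pos hd h1, ?_⟩, hP, ⟨n, rfl⟩⟩
    rw [Nat.le_div_iff_mul_le hd] at h2; rw [mul_comm]; exact h2
  · intro m hm
    rw [Finset.mem_filter] at hm
    obtain ⟨-, -, ⟨k, rfl⟩⟩ := hm
    rw [Nat.mul_div_cancel_left k hd]
  · intro n _
    exact Nat.mul_div_cancel_left n hd
  · intro m hm
    rw [Finset.mem_filter] at hm
    obtain ⟨-, -, ⟨k, rfl⟩⟩ := hm
    rw [Nat.mul_div_cancel_left k hd]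

/-- `λχ` is completely multiplicative (as a complex-valued function). [folklore] -/
theorem liouville_char_mul {q : ℕ} (χ : DirichletCharacter ℂ q) (d n : ℕ) :
    ((liouville (d * n) : ℤ) : ℂ) * χ ((d * n : ℕ) : ZMod q) =
      (((liouville d : ℤ) : ℂ) * χ (d : ZMod q)) * (((liouville n : ℤ) : ℂ) * χ (n : ZMod q)) := by
  rw [liouville_apply_mul, Nat.cast_mul, map_mul]; push_cast; ring

/-- `|λ(n) w| ≤ 1` for any `‖w‖ ≤ 1` (used with `w = χ(n)`; the special case is the tree's
`Lichtman2020.norm_liouville_mul_char_le`, not imported here to keep the import closure small). [folklore] -/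
theorem norm_liouville_mul_le {w : ℂ} (hw : ‖w‖ ≤ 1) (n : ℕ) :
    ‖((liouville n : ℤ) : ℂ) * w‖ ≤ 1 := by
  rw [norm_mul]
  have h1 : ‖((liouville n : ℤ) : ℂ)‖ ≤ 1 := by
    rw [Complex.norm_intCast]
    rcases eq_or_ne n 0 with rfl | hn
    · simp
    · rcases liouville_eq_one_or n hn with h | h <;> simp [h]
  calc ‖((liouville n : ℤ) : ℂ)‖ * ‖w‖ ≤ 1 * 1 := mul_le_mul h1 hw (norm_nonneg _) zero_le_one
    _ = 1 := one_mul _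

/-- The inner sums of the decomposition, reindexed: for `T ⊆ Pl` (primes disjoint from the primes
`Pss`), `∑_{0 < m ≤ N, (m,𝒟_s)=1, d_T ∣ m} λχ(m) = λχ(d_T) ∑_{0 < n ≤ N/d_T, (n,𝒟_s)=1} λχ(n)`. [folklore] -/
theorem inner_sum_eq {q : ℕ} (χ : DirichletCharacter ℂ q) {Pss T : Finset ℕ}
    (hPss : ∀ p ∈ Pss, p.Prime) (hT : ∀ p ∈ T, p.Prime) (hdisj : ∀ p ∈ Pss, p ∉ T) (N : ℕ) :
    ∑ m ∈ (Ioc 0 N).filter (fun m : ℕ => (∀ p ∈ Pss, ¬ p ∣ m) ∧ prodSet T ∣ m),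
        ((liouville m : ℤ) : ℂ) * χ (m : ZMod q) =
      (((liouville (prodSet T) : ℤ) : ℂ) * χ (prodSet T : ZMod q)) *
        ∑ n ∈ (Ioc 0 (N / prodSet T)).filter (fun n : ℕ => ∀ p ∈ Pss, ¬ p ∣ n),
          ((liouville n : ℤ) : ℂ) * χ (n : ZMod q) := by
  have hd := prodSet_pos hT
  rw [sum_filter_dvd_eq hd N (fun m => ∀ p ∈ Pss, ¬ p ∣ m), Finset.mul_sum]
  have hiff : ∀ n : ℕ, (∀ p ∈ Pss, ¬ p ∣ prodSet T * n) ↔ (∀ p ∈ Pss, ¬ p ∣ n) := by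
    intro n
    refine forall₂_congr fun p hp => not_congr ?_
    rw [(hPss p hp).dvd_mul]
    constructor
    · rintro (h | h)
      · exact absurd ((prime_dvd_prodSet_iff hT (hPss p hp)).1 h) (hdisj p hp)
      · exact h
    · exact Or.inr
  rw [Finset.filter_congr (fun n _ => hiff n)]
  refine Finset.sum_congr rfl fun n _ => ?_
  rw [liouville_char_mul]

/-! ### The large subsets: counting and the exponential moment -/

/-- `#{0 < m ≤ N : d ∣ m} = N/d`. [folklore] -/
theorem card_Ioc_filter_dvd (N : ℕ) {d : ℕ} (hd : 0 < d) :
    #((Ioc 0 N).filter (fun m : ℕ => d ∣ m)) = N / d := by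
  have := BFI.card_filter_dvd_eq hd 0 N (fun _ => True)
  simp only [and_true, Finset.filter_true, Nat.zero_div, Nat.card_Ioc, Nat.sub_zero] at this
  convert this using 2

/-- Double counting: `∑_{T ∈ 𝒯} ⌊N/d_T⌋ = ∑_{0 < m ≤ N} #{T ∈ 𝒯 : d_T ∣ m}`. [folklore] -/
theorem sum_div_prodSet_eq (𝒯 : Finset (Finset ℕ)) (h𝒯 : ∀ T ∈ 𝒯, ∀ p ∈ T, p.Prime) (N : ℕ) :
    ∑ T ∈ 𝒯, ((N / prodSet T : ℕ) : ℝ) = ∑ m ∈ Ioc 0 N, (#(𝒯.filter (fun T => prodSet T ∣ m)) : ℝ) := by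
  calc ∑ T ∈ 𝒯, ((N / prodSet T : ℕ) : ℝ)
      = ∑ T ∈ 𝒯, ∑ m ∈ Ioc 0 N, (if prodSet T ∣ m then (1 : ℝ) else 0) := by
        refine Finset.sum_congr rfl fun T hT => ?_
        rw [← Finset.sum_filter, Finset.sum_const, nsmul_eq_mul, mul_one,
          card_Ioc_filter_dvd N (prodSet_pos (h𝒯 T hT))]
    _ = ∑ m ∈ Ioc 0 N, ∑ T ∈ 𝒯, (if prodSet T ∣ m then (1 : ℝ) else 0) := Finset.sum_comm
    _ = _ := by
        refine Finset.sum_congr rfl fun m _ => ?_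
        rw [← Finset.sum_filter, Finset.sum_const, nsmul_eq_mul, mul_one]

/-- A squarefree product of `k` primes below `z₀` is `< z₀^k`; hence if `d_T > R` with all primes
of `T` below `z₀ > 1`, then `log R < #T · log z₀`. [folklore] -/
theorem card_mul_log_gt {T : Finset ℕ} (hT : ∀ p ∈ T, p.Prime) {z₀ R : ℝ}
    (hTz : ∀ p ∈ T, (p : ℝ) < z₀) (hR : 0 < R) (hd : R < prodSet T) :
    Real.log R < #T * Real.log z₀ := by
  have h1 : (prodSet T : ℝ) ≤ z₀ ^ #T := by
    unfold prodSet
    push_cast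
    rw [← Finset.prod_const]
    exact Finset.prod_le_prod (fun p _ => Nat.cast_nonneg p) fun p hp => (hTz p hp).le
  have h2 : Real.log R < Real.log ((prodSet T : ℕ) : ℝ) := Real.log_lt_log hR hd
  have h3 : Real.log ((prodSet T : ℕ) : ℝ) ≤ #T * Real.log z₀ := by
    rw [← Real.log_pow]
    exact Real.log_le_log (by exact_mod_cast prodSet_pos hT) h1
  linarith

/-- **The large subsets, pointwise**: for `0 < m`,
`#{T ⊆ Pl : d_T ∣ m, d_T > R} ≤ 2^{ω(m)} 𝟙[log R/log z₀ < ω(m)]`, `ω(m) = #{p ∈ Pl : p ∣ m}`,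
when the primes of `Pl` are `< z₀`. [folklore] -/
theorem card_large_subsets_le {Pl : Finset ℕ} (hPl : ∀ p ∈ Pl, p.Prime) {z₀ R : ℝ} (hz₀ : 1 < z₀)
    (hPz : ∀ p ∈ Pl, (p : ℝ) < z₀) (hR : 0 < R) (m : ℕ) :
    (#(Pl.powerset.filter (fun T => prodSet T ∣ m ∧ R < prodSet T)) : ℝ) ≤
      if Real.log R / Real.log z₀ < #(Pl.filter (· ∣ m)) then (2 : ℝ) ^ #(Pl.filter (· ∣ m)) else 0 := by
  have hlogz : 0 < Real.log z₀ := Real.log_pos hz₀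
  split_ifs with h
  · calc (#(Pl.powerset.filter (fun T => prodSet T ∣ m ∧ R < prodSet T)) : ℝ)
        ≤ #(Pl.powerset.filter (fun T => prodSet T ∣ m)) := by
          exact_mod_cast Finset.card_le_card fun T hT => by
            rw [Finset.mem_filter] at hT ⊢; exact ⟨hT.1, hT.2.1⟩
      _ = #((Pl.filter (· ∣ m)).powerset) := by rw [filter_powerset_prodSet_dvd hPl]
      _ = (2 : ℝ) ^ #(Pl.filter (· ∣ m)) := by rw [Finset.card_powerset]; push_cast; ring
  · -- no large subset: each `T` with `d_T ∣ m` has `#T ≤ ω(m) ≤ log R/log z₀`, so `d_T ≤ R`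
    have hempty : Pl.powerset.filter (fun T => prodSet T ∣ m ∧ R < prodSet T) = ∅ := by
      rw [Finset.filter_eq_empty_iff]
      rintro T hT ⟨hdvd, hbig⟩
      rw [Finset.mem_powerset] at hT
      have hTp : ∀ p ∈ T, p.Prime := fun p hp => hPl p (hT hp)
      have hTsub : T ⊆ Pl.filter (· ∣ m) := fun p hp =>
        Finset.mem_filter.2 ⟨hT hp, (prodSet_dvd_iff hTp m).1 hdvd p hp⟩
      have hcard : (#T : ℝ) ≤ #(Pl.filter (· ∣ m)) := by exact_mod_cast Finset.card_le_card hTsub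
      have hlt := card_mul_log_gt hTp (fun p hp => hPz p (hT hp)) hR hbig
      apply h
      rw [div_lt_iff₀ hlogz]
      calc Real.log R < #T * Real.log z₀ := hlt
        _ ≤ #(Pl.filter (· ∣ m)) * Real.log z₀ := mul_le_mul_of_nonneg_right hcard hlogz.le
    rw [hempty, Finset.card_empty, Nat.cast_zero]

/-- **Chernoff**: `2^ω 𝟙[k < ω] ≤ e^{-tk} (2e^t)^ω` for `t ≥ 0`. [folklore] -/
theorem chernoff_pointwise {ω : ℕ} {k t : ℝ} (ht : 0 ≤ t) :
    (if k < ω then (2 : ℝ) ^ ω else 0) ≤ Real.exp (-(t * k)) * (2 * Real.exp t) ^ ω := by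
  split_ifs with h
  · rw [mul_pow, ← Real.exp_nat_mul, mul_comm (2 ^ ω : ℝ), ← mul_assoc, ← Real.exp_add]
    have h1 : 1 ≤ Real.exp (-(t * k) + ω * t) := Real.one_le_exp (by nlinarith)
    calc (2 : ℝ) ^ ω = 1 * 2 ^ ω := (one_mul _).symm
      _ ≤ Real.exp (-(t * k) + ω * t) * 2 ^ ω := by gcongr
  · positivity

/-- **The exponential moment**: for `a ≥ 0`,
`∑_{0 < m ≤ N} (1 + a)^{ω(m)} ≤ N ∏_{p ∈ Pl} (1 + a/p)`. [folklore] -/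
theorem moment_bound {Pl : Finset ℕ} (hPl : ∀ p ∈ Pl, p.Prime) {a : ℝ} (ha : 0 ≤ a) (N : ℕ) :
    ∑ m ∈ Ioc 0 N, (1 + a) ^ #(Pl.filter (· ∣ m)) ≤ N * ∏ p ∈ Pl, (1 + a / p) := by
  -- `(1+a)^{ω(m)} = ∑_{T ⊆ Pl(m)} a^{#T} = ∑_{T ⊆ Pl, d_T ∣ m} a^{#T}`
  have h1 : ∀ m ∈ Ioc 0 N, (1 + a) ^ #(Pl.filter (· ∣ m)) =
      ∑ T ∈ Pl.powerset, if prodSet T ∣ m then a ^ #T else 0 := by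
    intro m _
    rw [← Finset.sum_filter, filter_powerset_prodSet_dvd hPl]
    have := Finset.prod_one_add (f := fun _ : ℕ => a) (Pl.filter (· ∣ m))
    simp only [Finset.prod_const] at this
    rw [this]
  rw [Finset.sum_congr rfl h1, Finset.sum_comm]
  -- `∑_T a^{#T} ⌊N/d_T⌋ ≤ N ∑_T a^{#T}/d_T = N ∏ (1 + a/p)`
  have h2 : ∀ T ∈ Pl.powerset, ∑ m ∈ Ioc 0 N, (if prodSet T ∣ m then a ^ #T else 0)
      ≤ N * (a ^ #T / prodSet T) := by
    intro T hT
    rw [Finset.mem_powerset] at hT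
    have hTp : ∀ p ∈ T, p.Prime := fun p hp => hPl p (hT hp)
    have hd := prodSet_pos hTp
    rw [← Finset.sum_filter, Finset.sum_const, nsmul_eq_mul, card_Ioc_filter_dvd N hd]
    calc ((N / prodSet T : ℕ) : ℝ) * a ^ #T ≤ ((N : ℝ) / prodSet T) * a ^ #T :=
          mul_le_mul_of_nonneg_right Nat.cast_div_le (by positivity)
      _ = N * (a ^ #T / prodSet T) := by ring
  refine (Finset.sum_le_sum h2).trans ?_
  rw [← Finset.mul_sum, Finset.prod_one_add]
  refine mul_le_mul_of_nonneg_left (le_of_eq (Finset.sum_congr rfl fun T hT => ?_)) (Nat.cast_nonneg N)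
  rw [Finset.prod_div_distrib, Finset.prod_const, prodSet, Nat.cast_prod]


/-! ### Mertens over the window `[z₁, z₀)` and the products over `𝒫_ℓ` -/

/-- `∏_{p ∈ Pl} (1 + a/p) ≤ exp(a ∑_{p ∈ Pl} 1/p)` for `a ≥ 0`. [folklore] -/
theorem prod_one_add_div_le_exp {Pl : Finset ℕ} {a : ℝ} (ha : 0 ≤ a) :
    ∏ p ∈ Pl, (1 + a / p) ≤ Real.exp (a * ∑ p ∈ Pl, (1 : ℝ) / p) := by
  rw [Finset.mul_sum, Real.exp_sum]
  refine Finset.prod_le_prod (fun p _ => by positivity) fun p _ => ?_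
  rw [mul_one_div]
  have := Real.add_one_le_exp (a / p); linarith

/-- **Mertens over `𝒫_ℓ ⊂ [z₁, z₀)`**: `∑_{p ∈ Pl} 1/p ≤ log log z₀ − log log z₁ + c₀`,
`c₀ = 9/2 + 6/log 2` (the tree's `sum_primesWindow_one_div_le`). [folklore] -/
theorem sum_inv_le_of_window {Pl : Finset ℕ} (hPl : ∀ p ∈ Pl, p.Prime) {z₁ z₀ : ℝ} (hz₁ : 2 ≤ z₁)
    (hz : z₁ ≤ z₀) (hlo : ∀ p ∈ Pl, z₁ ≤ (p : ℝ)) (hhi : ∀ p ∈ Pl, (p : ℝ) < z₀) :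
    ∑ p ∈ Pl, (1 : ℝ) / p ≤
      Real.log (Real.log z₀) - Real.log (Real.log z₁) + (9 / 2 + 6 / Real.log 2) := by
  have hsub : Pl ⊆ (Nat.primesBelow ⌈z₀⌉₊).filter (fun p : ℕ => z₁ ≤ (p : ℝ)) := fun p hp =>
    Finset.mem_filter.2 ⟨Nat.mem_primesBelow.2 ⟨Nat.lt_ceil.2 (hhi p hp), hPl p hp⟩, hlo p hp⟩
  exact (Finset.sum_le_sum_of_subset_of_nonneg hsub fun p _ _ => by positivity).trans
    (sum_primesWindow_one_div_le hz₁ hz)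

/-! ### The structural bound -/

/-- The hypothesis shape of the sieve half (`exists_sifted_sum_bound`) with a given constant. [folklore] -/
def SieveHalf (C : ℝ) : Prop :=
  ∀ (Ps : Finset ℕ) (N q : ℕ), 0 < q → ∀ χ : DirichletCharacter ℂ q,
    (∀ p ∈ Ps, p.Prime) → (∀ p ∈ Ps, q < p) → ∀ z D ε : ℝ, 2 ≤ z → z ≤ D →
    (∀ p ∈ Ps, (p : ℝ) < z) → 0 ≤ ε → ∀ M₀ : ℕ, D * (M₀ + 1) ≤ N →
    (∀ c : ZMod q, ∀ M : ℕ, M₀ ≤ M →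
      |∑ m ∈ (Ioc 0 M).filter (fun m : ℕ => (m : ZMod q) = c), (liouville m : ℝ)| ≤ ε * M) →
    ‖∑ n ∈ (Icc 1 N).filter (fun n : ℕ => ∀ p ∈ Ps, ¬ p ∣ n),
        ((liouville n : ℤ) : ℂ) * χ (n : ZMod q)‖ ≤
      C * N * Real.exp (-(Real.log D / Real.log z)) + 2 * q * D + q * ε * N * (1 + Real.log D)

/-- The trivial bound `‖T_M‖ ≤ M`. [folklore] -/
theorem norm_sifted_sum_le_self {q : ℕ} (χ : DirichletCharacter ℂ q) (P : ℕ → Prop)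
    [DecidablePred P] (M : ℕ) :
    ‖∑ n ∈ (Ioc 0 M).filter P, ((liouville n : ℤ) : ℂ) * χ (n : ZMod q)‖ ≤ M := by
  calc ‖∑ n ∈ (Ioc 0 M).filter P, ((liouville n : ℤ) : ℂ) * χ (n : ZMod q)‖
      ≤ ∑ n ∈ (Ioc 0 M).filter P, ‖((liouville n : ℤ) : ℂ) * χ (n : ZMod q)‖ := norm_sum_le _ _
    _ ≤ ∑ _n ∈ (Ioc 0 M).filter P, (1 : ℝ) := Finset.sum_le_sum fun n _ => norm_liouville_mul_le (χ.norm_le_one _) n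
    _ ≤ ∑ _n ∈ Ioc 0 M, (1 : ℝ) :=
        Finset.sum_le_sum_of_subset_of_nonneg (Finset.filter_subset _ _) fun _ _ _ => zero_le_one
    _ = M := by simp

/-- **The structural bound.**  Let `L = log x`, `N = ⌊x⌋`, `1 ≤ q`, `χ (mod q)`, `Ps` primes with
`q < p < z₀`; split `Ps` at `z₁` into `Pss` (`p < z₁`) and `Pl` (`z₁ ≤ p`).  Assume the sieve half
with constant `C`, a progression bound `|∑_{0 < m ≤ M, m ≡ c} λ(m)| ≤ εM` for `M ≥ M₀`, and the side
conditions `2 ≤ z₁ ≤ D`, `D(M₀+1) ≤ √x − 2`, `1 ≤ x`, `1 < z₀`.  Then for every `t ≥ 0`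
`‖S₀‖ ≤ Pr (C x e^{-log D/log z₁} + 2qD√x + qεx(1 + log D)) + e^{-t log √x/log z₀} x Pr_t`,
`Pr = ∏_{p ∈ Pl}(1 + 1/p)`, `Pr_t = ∏_{p ∈ Pl}(1 + (2e^t − 1)/p)`. [cite: Lichtman2020, Lemma 4.8] -/
theorem structural_bound {C : ℝ} (hC : 0 < C) (hFL : SieveHalf C) {x z₀ z₁ D ε t : ℝ} {M₀ : ℕ}
    {q : ℕ} (hq : 0 < q) (χ : DirichletCharacter ℂ q) {Ps : Finset ℕ}
    (hPs : ∀ p ∈ Ps, p.Prime ∧ q < p ∧ (p : ℝ) < z₀)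
    (hx : 1 ≤ x) (hz₀ : 1 < z₀) (hz₁ : 2 ≤ z₁) (hzD : z₁ ≤ D) (hε : 0 ≤ ε) (ht : 0 ≤ t)
    (hDM : D * (M₀ + 1) ≤ Real.sqrt x - 2)
    (hΛ : ∀ c : ZMod q, ∀ M : ℕ, M₀ ≤ M →
      |∑ m ∈ (Ioc 0 M).filter (fun m : ℕ => (m : ZMod q) = c), (liouville m : ℝ)| ≤ ε * M) :
    ‖∑ m ∈ (Icc 1 ⌊x⌋₊).filter (fun m : ℕ => ∀ p ∈ Ps, ¬ p ∣ m),
        ((liouville m : ℤ) : ℂ) * χ (m : ZMod q)‖ ≤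
      (∏ p ∈ Ps.filter (fun p : ℕ => z₁ ≤ (p : ℝ)), (1 + 1 / (p : ℝ))) *
          (C * x * Real.exp (-(Real.log D / Real.log z₁)) + 2 * q * D * Real.sqrt x
            + q * ε * x * (1 + Real.log D))
        + Real.exp (-(t * (Real.log (Real.sqrt x) / Real.log z₀))) * x *
          ∏ p ∈ Ps.filter (fun p : ℕ => z₁ ≤ (p : ℝ)), (1 + (2 * Real.exp t - 1) / (p : ℝ)) := by
  -- notation
  set N := ⌊x⌋₊ with hN
  set Pss := Ps.filter (fun p : ℕ => (p : ℝ) < z₁) with hPss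
  set Pl := Ps.filter (fun p : ℕ => z₁ ≤ (p : ℝ)) with hPl
  have hx0 : 0 < x := by linarith
  have hD0 : 0 < D := by linarith
  have hNx : (N : ℝ) ≤ x := Nat.floor_le hx0.le
  have hsqrt0 : 0 < Real.sqrt x := Real.sqrt_pos.2 hx0
  have hPlp : ∀ p ∈ Pl, p.Prime := fun p hp => (hPs p (Finset.mem_filter.1 hp).1).1
  have hPssp : ∀ p ∈ Pss, p.Prime := fun p hp => (hPs p (Finset.mem_filter.1 hp).1).1
  have hPlz : ∀ p ∈ Pl, (p : ℝ) < z₀ := fun p hp => (hPs p (Finset.mem_filter.1 hp).1).2.2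
  have hunion : ∀ m : ℕ, (∀ p ∈ Ps, ¬ p ∣ m) ↔ (∀ p ∈ Pss, ¬ p ∣ m) ∧ ∀ p ∈ Pl, ¬ p ∣ m := by
    intro m
    constructor
    · intro h; exact ⟨fun p hp => h p (Finset.mem_filter.1 hp).1, fun p hp => h p (Finset.mem_filter.1 hp).1⟩
    · rintro ⟨h1, h2⟩ p hp
      rcases lt_or_ge (p : ℝ) z₁ with hlt | hge
      · exact h1 p (Finset.mem_filter.2 ⟨hp, hlt⟩)
      · exact h2 p (Finset.mem_filter.2 ⟨hp, hge⟩)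
  have hdisj : ∀ T ∈ Pl.powerset, ∀ p ∈ Pss, p ∉ T := by
    intro T hT p hp hpT
    have h1 := (Finset.mem_filter.1 hp).2
    have h2 := (Finset.mem_filter.1 (Finset.mem_powerset.1 hT hpT)).2
    linarith
  -- the decomposition
  have hIcc : Icc 1 N = Ioc 0 N := rfl
  rw [hIcc, sifted_sum_decomposition hPlp hunion]
  set TN : ℕ → ℂ := fun M => ∑ n ∈ (Ioc 0 M).filter (fun n : ℕ => ∀ p ∈ Pss, ¬ p ∣ n),
    ((liouville n : ℤ) : ℂ) * χ (n : ZMod q) with hTN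
  have hterm : ∀ T ∈ Pl.powerset, ‖(-1 : ℂ) ^ #T *
      ∑ m ∈ (Ioc 0 N).filter (fun m : ℕ => (∀ p ∈ Pss, ¬ p ∣ m) ∧ prodSet T ∣ m),
        ((liouville m : ℤ) : ℂ) * χ (m : ZMod q)‖ ≤ ‖TN (N / prodSet T)‖ := by
    intro T hT
    have hTp : ∀ p ∈ T, p.Prime := fun p hp => hPlp p (Finset.mem_powerset.1 hT hp)
    rw [inner_sum_eq χ hPssp hTp (hdisj T hT) N, norm_mul, norm_mul, norm_pow, norm_neg, norm_one,
      one_pow, one_mul]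
    calc _ ≤ 1 * ‖TN (N / prodSet T)‖ :=
          mul_le_mul_of_nonneg_right (norm_liouville_mul_le (χ.norm_le_one _) _) (norm_nonneg _)
      _ = _ := one_mul _
  refine (norm_sum_le _ _).trans ((Finset.sum_le_sum hterm).trans ?_)
  -- split into small and large `d_T`
  rw [← Finset.sum_filter_add_sum_filter_not Pl.powerset (fun T => (prodSet T : ℝ) ≤ Real.sqrt x)]
  refine add_le_add ?_ ?_
  · -- small `d_T`: the sieve half
    have hsmall : ∀ T ∈ Pl.powerset.filter (fun T => (prodSet T : ℝ) ≤ Real.sqrt x),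
        ‖TN (N / prodSet T)‖ ≤ (1 / (prodSet T : ℝ)) *
          (C * x * Real.exp (-(Real.log D / Real.log z₁)) + 2 * q * D * Real.sqrt x
            + q * ε * x * (1 + Real.log D)) := by
      intro T hT
      rw [Finset.mem_filter] at hT
      have hTp : ∀ p ∈ T, p.Prime := fun p hp => hPlp p (Finset.mem_powerset.1 hT.1 hp)
      have hd := prodSet_pos hTp
      have hd' : (0 : ℝ) < prodSet T := by exact_mod_cast hd
      set N' := N / prodSet T with hN'
      -- `N' ≥ √x − 2 ≥ D (M₀+1)`
      have hN'lo : Real.sqrt x - 2 ≤ (N' : ℕ) := by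
        have h1 : (N : ℝ) / prodSet T - 1 ≤ (N' : ℕ) := by
          rw [hN', div_sub_one hd'.ne', div_le_iff₀ hd']
          have := Nat.lt_div_mul_add (a := N) hd
          have : ((N : ℕ) : ℝ) < ((N / prodSet T * prodSet T + prodSet T : ℕ) : ℝ) := by exact_mod_cast this
          push_cast at this
          linarith
        have h2 : Real.sqrt x - 1 ≤ (N : ℝ) / prodSet T := by
          rw [le_div_iff₀ hd']
          have hN1 : x - 1 ≤ N := by have := Nat.lt_floor_add_one x; rw [← hN] at this; linarith
          have hsx : Real.sqrt x * Real.sqrt x = x := Real.mul_self_sqrt hx0.le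
          have h1x : 1 ≤ Real.sqrt x := by rw [show (1:ℝ) = Real.sqrt 1 by simp]; exact Real.sqrt_le_sqrt hx
          nlinarith [hT.2, hsqrt0]
        linarith
      have hDN : D * (M₀ + 1) ≤ (N' : ℕ) := hDM.trans hN'lo
      have key := hFL Pss N' q hq χ hPssp (fun p hp => (hPs p (Finset.mem_filter.1 hp).1).2.1)
        z₁ D ε hz₁ hzD (fun p hp => (Finset.mem_filter.1 hp).2) hε M₀ hDN hΛ
      have hIcc' : Icc 1 N' = Ioc 0 N' := rfl
      rw [hIcc'] at key
      refine key.trans ?_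
      have hN'le : (N' : ℝ) ≤ x * (1 / prodSet T) := by
        rw [mul_one_div]; exact Nat.cast_div_le.trans (div_le_div_of_nonneg_right hNx hd'.le)
      have hone : (1 : ℝ) ≤ Real.sqrt x * (1 / prodSet T) := by
        rw [mul_one_div, le_div_iff₀ hd', one_mul]; exact hT.2
      have hq0 : (0 : ℝ) ≤ q := Nat.cast_nonneg q
      have hD0 : 0 ≤ D := by linarith
      have hlogD : 0 ≤ 1 + Real.log D := by
        have : 0 ≤ Real.log D := Real.log_nonneg (by linarith); linarith
      have he0 : 0 ≤ Real.exp (-(Real.log D / Real.log z₁)) := (Real.exp_pos _).le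
      calc C * N' * Real.exp (-(Real.log D / Real.log z₁)) + 2 * q * D + q * ε * N' * (1 + Real.log D)
          ≤ C * (x * (1 / prodSet T)) * Real.exp (-(Real.log D / Real.log z₁))
            + 2 * q * D * (Real.sqrt x * (1 / prodSet T))
            + q * ε * (x * (1 / prodSet T)) * (1 + Real.log D) := by
            refine add_le_add (add_le_add ?_ ?_) ?_
            · exact mul_le_mul_of_nonneg_right (mul_le_mul_of_nonneg_left hN'le hC.le) he0
            · calc (2 : ℝ) * q * D = 2 * q * D * 1 := (mul_one _).symm
                _ ≤ 2 * q * D * (Real.sqrt x * (1 / prodSet T)) :=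
                    mul_le_mul_of_nonneg_left hone (by positivity)
            · exact mul_le_mul_of_nonneg_right (mul_le_mul_of_nonneg_left hN'le (by positivity)) hlogD
        _ = _ := by ring
    calc ∑ T ∈ Pl.powerset.filter (fun T => (prodSet T : ℝ) ≤ Real.sqrt x), ‖TN (N / prodSet T)‖
        ≤ ∑ T ∈ Pl.powerset.filter (fun T => (prodSet T : ℝ) ≤ Real.sqrt x), (1 / (prodSet T : ℝ)) *
          (C * x * Real.exp (-(Real.log D / Real.log z₁)) + 2 * q * D * Real.sqrt x
            + q * ε * x * (1 + Real.log D)) := Finset.sum_le_sum hsmall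
      _ ≤ ∑ T ∈ Pl.powerset, (1 / (prodSet T : ℝ)) *
          (C * x * Real.exp (-(Real.log D / Real.log z₁)) + 2 * q * D * Real.sqrt x
            + q * ε * x * (1 + Real.log D)) := by
          refine Finset.sum_le_sum_of_subset_of_nonneg (Finset.filter_subset _ _) fun T _ _ => ?_
          have : 0 ≤ 1 + Real.log D := by
            have : 0 ≤ Real.log D := Real.log_nonneg (by linarith); linarith
          exact mul_nonneg (by positivity) (add_nonneg (add_nonneg (by positivity) (by positivity))
            (mul_nonneg (by positivity) this))
      _ = (∑ T ∈ Pl.powerset, (1 / (prodSet T : ℝ))) *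
          (C * x * Real.exp (-(Real.log D / Real.log z₁)) + 2 * q * D * Real.sqrt x
            + q * ε * x * (1 + Real.log D)) := by rw [Finset.sum_mul]
      _ = _ := by
          congr 1
          rw [Finset.prod_one_add]
          refine Finset.sum_congr rfl fun T _ => ?_
          rw [Finset.prod_div_distrib, Finset.prod_const_one, prodSet, Nat.cast_prod]
  · -- large `d_T`: trivial bound, double counting, Chernoff, moment
    set 𝒯 := Pl.powerset.filter (fun T => ¬ (prodSet T : ℝ) ≤ Real.sqrt x) with h𝒯
    have h𝒯p : ∀ T ∈ 𝒯, ∀ p ∈ T, p.Prime := fun T hT p hp =>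
      hPlp p (Finset.mem_powerset.1 (Finset.mem_filter.1 hT).1 hp)
    have h1 : ∑ T ∈ 𝒯, ‖TN (N / prodSet T)‖ ≤ ∑ T ∈ 𝒯, ((N / prodSet T : ℕ) : ℝ) :=
      Finset.sum_le_sum fun T _ => norm_sifted_sum_le_self χ _ _
    refine h1.trans ?_
    rw [sum_div_prodSet_eq 𝒯 h𝒯p N]
    -- `#{T ∈ 𝒯 : d_T ∣ m} = #{T ⊆ Pl : d_T ∣ m, √x < d_T}`
    have h2 : ∀ m ∈ Ioc 0 N, (#(𝒯.filter (fun T => prodSet T ∣ m)) : ℝ) ≤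
        Real.exp (-(t * (Real.log (Real.sqrt x) / Real.log z₀))) *
          (2 * Real.exp t) ^ #(Pl.filter (· ∣ m)) := by
      intro m _
      have hset : 𝒯.filter (fun T => prodSet T ∣ m) =
          Pl.powerset.filter (fun T => prodSet T ∣ m ∧ Real.sqrt x < prodSet T) := by
        ext T; simp only [h𝒯, Finset.mem_filter, not_le]; tauto
      rw [hset]
      refine (card_large_subsets_le hPlp hz₀ hPlz hsqrt0 m).trans ?_
      exact chernoff_pointwise ht
    refine (Finset.sum_le_sum h2).trans ?_
    rw [← Finset.mul_sum]
    have h3 := moment_bound hPlp (a := 2 * Real.exp t - 1)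
      (by have := Real.add_one_le_exp t; nlinarith [Real.exp_pos t]) N
    have h4 : ∑ m ∈ Ioc 0 N, (2 * Real.exp t) ^ #(Pl.filter (· ∣ m)) ≤
        x * ∏ p ∈ Pl, (1 + (2 * Real.exp t - 1) / (p : ℝ)) := by
      rw [add_sub_cancel] at h3
      refine h3.trans (mul_le_mul_of_nonneg_right hNx (Finset.prod_nonneg fun p _ => ?_))
      have : 0 ≤ (2 * Real.exp t - 1) / (p : ℝ) := by
        apply div_nonneg _ (Nat.cast_nonneg p)
        have := Real.add_one_le_exp t; nlinarith [Real.exp_pos t]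
      linarith
    calc Real.exp (-(t * (Real.log (Real.sqrt x) / Real.log z₀))) *
          ∑ m ∈ Ioc 0 N, (2 * Real.exp t) ^ #(Pl.filter (· ∣ m))
        ≤ Real.exp (-(t * (Real.log (Real.sqrt x) / Real.log z₀))) *
          (x * ∏ p ∈ Pl, (1 + (2 * Real.exp t - 1) / (p : ℝ))) :=
          mul_le_mul_of_nonneg_left h4 (Real.exp_pos _).le
      _ = _ := by ring


/-! ### The parameters `z₀ = x^{1/log L}`, `z₁ = exp(L/(log L)²)` and the products over `𝒫_ℓ` -/

/-- Mertens' constant of the window bound. [folklore] -/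
def c₀ : ℝ := 9 / 2 + 6 / Real.log 2

/-- `0 ≤ c₀`. [folklore] -/
theorem c₀_nonneg : 0 ≤ c₀ := by
  unfold c₀; have := Real.log_pos (by norm_num : (1:ℝ) < 2); positivity

/-- **The products over `𝒫_ℓ`.**  With `L = log x`, `log L ≥ 1`, `z₀ = x^{1/log L}`,
`z₁ = exp(L/(log L)²) ≥ 2`, and `Pl` primes in `[z₁, z₀)`: for `a ≥ 0`,
`∏_{p ∈ Pl} (1 + a/p) ≤ (e^{c₀} log L)^a`. [folklore] -/
theorem prod_le_loglog_pow {Pl : Finset ℕ} (hPl : ∀ p ∈ Pl, p.Prime) {x : ℝ} (hx : 1 < x)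
    (hL : 1 ≤ Real.log (Real.log x))
    (hz₁ : 2 ≤ Real.exp (Real.log x / Real.log (Real.log x) ^ 2))
    (hlo : ∀ p ∈ Pl, Real.exp (Real.log x / Real.log (Real.log x) ^ 2) ≤ (p : ℝ))
    (hhi : ∀ p ∈ Pl, (p : ℝ) < x ^ (1 / Real.log (Real.log x))) {a : ℝ} (ha : 0 ≤ a) :
    ∏ p ∈ Pl, (1 + a / p) ≤ (Real.exp c₀ * Real.log (Real.log x)) ^ a := by
  set L := Real.log x with hLdef
  set v := Real.log L with hv
  have hL0 : 0 < L := Real.log_pos hx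
  have hv0 : 0 < v := by linarith
  have hx0 : 0 < x := by linarith
  -- `log z₀ = L/v`, `log z₁ = L/v²`
  have hz₀ : Real.log (x ^ (1 / Real.log (Real.log x))) = L / v := by
    rw [Real.log_rpow hx0]; rw [hv, hLdef]; ring
  have hz₁' : Real.log (Real.exp (Real.log x / Real.log (Real.log x) ^ 2)) = L / v ^ 2 := by
    rw [Real.log_exp]
  have hzz : Real.exp (Real.log x / Real.log (Real.log x) ^ 2) ≤ x ^ (1 / Real.log (Real.log x)) := by
    rw [← Real.exp_log (Real.rpow_pos_of_pos hx0 _), Real.exp_le_exp, hz₀]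
    change L / v ^ 2 ≤ L / v
    rw [div_le_div_iff_of_pos_left hL0 (by positivity) hv0]
    nlinarith
  have hsum := sum_inv_le_of_window hPl hz₁ hzz hlo hhi
  rw [hz₀, hz₁'] at hsum
  -- `log log z₀ − log log z₁ = log v`
  have hll : Real.log (L / v) - Real.log (L / v ^ 2) = Real.log v := by
    rw [Real.log_div hL0.ne' hv0.ne', Real.log_div hL0.ne' (by positivity), Real.log_pow]
    push_cast; ring
  rw [hll] at hsum
  change ∑ p ∈ Pl, (1 : ℝ) / p ≤ Real.log v + c₀ at hsum
  calc ∏ p ∈ Pl, (1 + a / p) ≤ Real.exp (a * ∑ p ∈ Pl, (1 : ℝ) / p) := prod_one_add_div_le_exp ha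
    _ ≤ Real.exp (a * (Real.log v + c₀)) := Real.exp_le_exp.2 (mul_le_mul_of_nonneg_left hsum ha)
    _ = (Real.exp c₀ * v) ^ a := by
        rw [mul_comm a, Real.exp_mul, Real.exp_add, Real.exp_log hv0, mul_comm]

/-! ### The progression bound in the form needed by the sieve half -/

/-- From Siegel–Walfisz for `λ` (exponents `2A`, `B'`, constant `C₁ ≥ 0`) to the uniform bound
`|∑_{0 < m ≤ M, m ≡ c} λ(m)| ≤ ε M` for `M ≥ M₀ = ⌈x^{1/8}⌉`, `ε = C₁ 8^{B'}/L^{B'}`, when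
`q ≤ L^A`, `L ≥ 64`, `x^{1/8} ≥ 2`. [folklore] -/
theorem progression_bound {A B' C₁ x : ℝ} (hA : 0 < A) (hB' : 0 ≤ B') (hC₁ : 0 ≤ C₁)
    (hSW : ∀ y : ℝ, 2 ≤ y → ∀ q : ℕ, 1 ≤ q → (q : ℝ) ≤ Real.log y ^ (2 * A) → ∀ a : ZMod q,
      |∑ n ∈ (Icc 1 ⌊y⌋₊).filter (fun n : ℕ => (n : ZMod q) = a), (liouville n : ℝ)| ≤
        C₁ * y / Real.log y ^ B')
    (hx1 : 1 < x) (hL : 64 ≤ Real.log x) (hx8 : 2 ≤ x ^ (1 / 8 : ℝ)) {q : ℕ} (hq : 1 ≤ q)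
    (hqA : (q : ℝ) ≤ Real.log x ^ A) (c : ZMod q) (M : ℕ) (hM : ⌈x ^ (1 / 8 : ℝ)⌉₊ ≤ M) :
    |∑ m ∈ (Ioc 0 M).filter (fun m : ℕ => (m : ZMod q) = c), (liouville m : ℝ)| ≤
      C₁ * 8 ^ B' / Real.log x ^ B' * M := by
  set L := Real.log x with hLdef
  have hL0 : 0 < L := by linarith
  have hx0 : 0 < x := by linarith
  have hMx : x ^ (1 / 8 : ℝ) ≤ M := (Nat.le_ceil _).trans (by exact_mod_cast hM)
  have hM2 : (2 : ℝ) ≤ M := hx8.trans hMx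
  have hM0 : (0 : ℝ) < M := by linarith
  -- `log M ≥ L/8`
  have hlogM : L / 8 ≤ Real.log M := by
    have := Real.log_le_log (by positivity) hMx
    rwa [Real.log_rpow hx0, mul_comm, ← div_eq_mul_one_div] at this
  have hlogM0 : 0 < Real.log M := by linarith
  -- `q ≤ (log M)^{2A}`
  have hq2 : (q : ℝ) ≤ Real.log M ^ (2 * A) := by
    refine hqA.trans ?_
    have h1 : L ≤ (L / 8) ^ 2 := by nlinarith
    calc L ^ A ≤ ((L / 8) ^ 2) ^ A := Real.rpow_le_rpow hL0.le h1 hA.le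
      _ = (L / 8) ^ (2 * A) := by rw [← Real.rpow_natCast, ← Real.rpow_mul (by positivity)]; norm_num
      _ ≤ Real.log M ^ (2 * A) := Real.rpow_le_rpow (by positivity) hlogM (by positivity)
  have key := hSW M hM2 q hq hq2 c
  rw [Nat.floor_natCast] at key
  have hIcc : Icc 1 M = Ioc 0 M := rfl
  rw [hIcc] at key
  refine key.trans ?_
  -- `C₁ M/(log M)^{B'} ≤ C₁ 8^{B'} L^{-B'} M`
  have hpow : (L / 8) ^ B' ≤ Real.log M ^ B' := Real.rpow_le_rpow (by positivity) hlogM hB'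
  have h8 : (L / 8) ^ B' = L ^ B' / 8 ^ B' := Real.div_rpow hL0.le (by norm_num) _
  have hL8 : 0 < (L / 8) ^ B' := Real.rpow_pos_of_pos (by positivity) _
  calc C₁ * M / Real.log M ^ B' ≤ C₁ * M / (L / 8) ^ B' :=
        div_le_div_of_nonneg_left (by positivity) hL8 hpow
    _ = C₁ * 8 ^ B' / L ^ B' * M := by rw [h8]; field_simp

/-! ### The eventual conditions -/

/-- The side conditions at `x`, collected. [folklore] -/
structure Conditions (A K a : ℝ) (x : ℝ) : Prop where
  hx : 3 ≤ x
  hL : 64 ≤ Real.log x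
  hv : 2 ≤ Real.log (Real.log x)
  hz₁ : 2 ≤ Real.exp (Real.log x / Real.log (Real.log x) ^ 2)
  hz₁D : Real.exp (Real.log x / Real.log (Real.log x) ^ 2) ≤ x ^ (1 / 4 : ℝ)
  hx8 : 3 ≤ x ^ (1 / 8 : ℝ)
  h7 : Real.exp c₀ * Real.log (Real.log x) * Real.exp (-(Real.log (Real.log x) ^ 2 / 4)) ≤
    (Real.log x ^ K)⁻¹
  h8 : Real.exp c₀ * Real.log (Real.log x) * Real.log x ^ (A + K) ≤ x ^ (1 / 4 : ℝ)
  h10 : (Real.exp c₀ * Real.log (Real.log x)) ^ a ≤ Real.log x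

/-- Elementary: eventually in `v`, `c + log v + b v ≤ e^v/4` (`b ≥ 0`). [folklore] -/
theorem eventually_lin_le_exp (c b : ℝ) (hb : 0 ≤ b) :
    ∀ᶠ v : ℝ in atTop, c + Real.log v + b * v ≤ Real.exp v / 4 := by
  have h1 := Real.tendsto_pow_mul_exp_neg_atTop_nhds_zero 1
  have h2 : ∀ᶠ v : ℝ in atTop, v ^ 1 * Real.exp (-v) ≤ 1 / (8 * (b + 1)) :=
    h1.eventually (ge_mem_nhds (by positivity))
  filter_upwards [h2, eventually_ge_atTop (max 1 (8 * |c|))] with v hv hv1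
  have hv0 : 1 ≤ v := (le_max_left _ _).trans hv1
  have hvc : 8 * |c| ≤ v := (le_max_right _ _).trans hv1
  rw [pow_one] at hv
  have he : 0 < Real.exp v := Real.exp_pos v
  have hve : v ≤ Real.exp v / (8 * (b + 1)) := by
    rw [le_div_iff₀ (by positivity)]
    have : v * Real.exp (-v) * (8 * (b + 1)) ≤ 1 := by
      rw [← le_div_iff₀ (by positivity)]; exact hv
    rw [Real.exp_neg] at this
    have h3 : v * (8 * (b + 1)) ≤ Real.exp v := by
      have := mul_le_mul_of_nonneg_right this he.le
      rw [one_mul] at this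
      calc v * (8 * (b + 1)) = v * (Real.exp v)⁻¹ * (8 * (b + 1)) * Real.exp v := by
            field_simp
        _ ≤ Real.exp v := this
    linarith
  have hlogv : Real.log v ≤ v := (Real.log_le_sub_one_of_pos (by linarith)).trans (by linarith)
  have hcv : c ≤ v / 8 := by have := le_abs_self c; linarith
  -- `c + log v + b v ≤ v/8 + v + b v ≤ (b + 2) v ≤ e^v (b+2)/(8(b+1)) ≤ e^v/4`
  have h4 : (b + 2) * v ≤ Real.exp v / 4 := by
    calc (b + 2) * v ≤ (b + 2) * (Real.exp v / (8 * (b + 1))) :=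
          mul_le_mul_of_nonneg_left hve (by linarith)
      _ = Real.exp v * ((b + 2) / (8 * (b + 1))) := by ring
      _ ≤ Real.exp v * (1 / 4) := by
          refine mul_le_mul_of_nonneg_left ?_ he.le
          rw [div_le_div_iff₀ (by positivity) (by norm_num)]
          nlinarith
      _ = Real.exp v / 4 := by ring
  nlinarith

/-- Elementary: eventually in `v`, `(C v)^a ≤ e^v` (`C > 0`, `a ≥ 0`). [folklore] -/
theorem eventually_pow_le_exp {C a : ℝ} (hC : 0 < C) (ha : 0 ≤ a) :
    ∀ᶠ v : ℝ in atTop, (C * v) ^ a ≤ Real.exp v := by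
  -- `a log(Cv) = a log C + a log v ≤ v` eventually
  have h := (Real.isLittleO_log_id_atTop.def (show (0:ℝ) < 1 / (2 * (a + 1)) by positivity))
  filter_upwards [h, eventually_ge_atTop (max 1 (2 * a * |Real.log C|))] with v hv hv1
  have hv0 : 1 ≤ v := (le_max_left _ _).trans hv1
  have hvC : 2 * a * |Real.log C| ≤ v := (le_max_right _ _).trans hv1
  have hvpos : 0 < v := by linarith
  rw [Real.norm_of_nonneg (Real.log_nonneg hv0), id, Real.norm_of_nonneg hvpos.le] at hv
  rw [← Real.exp_log (Real.rpow_pos_of_pos (by positivity) a), Real.exp_le_exp,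
    Real.log_rpow (by positivity), Real.log_mul hC.ne' hvpos.ne']
  have h1 : a * Real.log C ≤ v / 2 := by
    have := le_abs_self (Real.log C); nlinarith [abs_nonneg (Real.log C)]
  have h2 : a * Real.log v ≤ v / 2 := by
    calc a * Real.log v ≤ a * (1 / (2 * (a + 1)) * v) := mul_le_mul_of_nonneg_left hv ha
      _ = v * (a / (2 * (a + 1))) := by ring
      _ ≤ v * (1 / 2) := by
          refine mul_le_mul_of_nonneg_left ?_ hvpos.le
          rw [div_le_div_iff₀ (by positivity) (by norm_num)]; nlinarith
      _ = v / 2 := by ring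
  nlinarith

/-- **The side conditions hold for all large `x`.** [folklore] -/
theorem eventually_conditions (A K a : ℝ) (hA : 0 < A) (hK : 0 < K) (ha : 0 ≤ a) :
    ∀ᶠ x : ℝ in atTop, Conditions A K a x := by
  have hll : Tendsto (fun x : ℝ => Real.log (Real.log x)) atTop atTop :=
    Real.tendsto_log_atTop.comp Real.tendsto_log_atTop
  -- conditions in `v = log log x`
  have hC8 := hll.eventually (eventually_lin_le_exp c₀ (A + K) (by positivity))
  have hC10 := hll.eventually (eventually_pow_le_exp (Real.exp_pos c₀) ha)
  have hC1 := hll.eventually ((Real.tendsto_pow_mul_exp_neg_atTop_nhds_zero 2).eventually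
    (ge_mem_nhds (show (0:ℝ) < 1 / 2 by norm_num)))
  have hx8 : ∀ᶠ x : ℝ in atTop, 3 ≤ x ^ (1 / 8 : ℝ) :=
    (tendsto_rpow_atTop (by norm_num : (0:ℝ) < 1 / 8)).eventually_ge_atTop 3
  filter_upwards [hC8, hC10, hC1, hx8, eventually_ge_atTop 3,
    Real.tendsto_log_atTop.eventually_ge_atTop 64,
    hll.eventually_ge_atTop (max 2 (max (4 * (K + 2)) c₀))] with x h8 h10 h1 hx8' hx3 hL hv
  set L := Real.log x with hLdef
  set v := Real.log L with hvdef
  have hv2 : 2 ≤ v := (le_max_left _ _).trans hv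
  have hvK : 4 * (K + 2) ≤ v := (le_max_left _ _).trans ((le_max_right _ _).trans hv)
  have hvc : c₀ ≤ v := (le_max_right _ _).trans ((le_max_right _ _).trans hv)
  have hL0 : 0 < L := by linarith
  have hv0 : 0 < v := by linarith
  have hx0 : 0 < x := by linarith
  have hLv : Real.exp v = L := by rw [hvdef, Real.exp_log hL0]
  -- C1: `L/v² ≥ 2 log 2`-ish: from `v² e^{-v} ≤ 1/2`, `L/v² = e^v/v² ≥ 2`
  have hLv2 : 2 ≤ L / v ^ 2 := by
    rw [Real.exp_neg, hLv] at h1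
    rw [le_div_iff₀ (by positivity)]
    have : v ^ 2 * L⁻¹ * L ≤ 1 / 2 * L := mul_le_mul_of_nonneg_right h1 hL0.le
    rw [inv_mul_cancel_right₀ hL0.ne'] at this
    linarith
  have hz₁ : 2 ≤ Real.exp (L / v ^ 2) := by
    have := Real.add_one_le_exp (L / v ^ 2); linarith
  -- C2: `L/v² ≤ L/4` since `v ≥ 2`
  have hz₁D : Real.exp (L / v ^ 2) ≤ x ^ (1 / 4 : ℝ) := by
    rw [Real.rpow_def_of_pos hx0, Real.exp_le_exp, ← hLdef]
    rw [div_le_iff₀ (by positivity)]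
    have h4 : (4 : ℝ) ≤ v ^ 2 := by nlinarith
    nlinarith [mul_le_mul_of_nonneg_left h4 hL0.le]
  -- C7 (explicit): `c₀ + log v + K v ≤ v²/4`
  have h7 : Real.exp c₀ * v * Real.exp (-(v ^ 2 / 4)) ≤ (L ^ K)⁻¹ := by
    rw [← Real.exp_log hv0, ← Real.exp_add, ← Real.exp_add, Real.exp_log hv0,
      Real.rpow_def_of_pos hL0, ← Real.exp_neg, Real.exp_le_exp, ← hvdef]
    have hlogv : Real.log v ≤ v := (Real.log_le_sub_one_of_pos hv0).trans (by linarith)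
    nlinarith
  -- C8: `c₀ + log v + (A+K) v ≤ e^v/4 = L/4`, exponentiate
  have h8' : Real.exp c₀ * v * L ^ (A + K) ≤ x ^ (1 / 4 : ℝ) := by
    rw [← Real.exp_log hv0, Real.rpow_def_of_pos hL0, ← Real.exp_add, ← Real.exp_add,
      Real.rpow_def_of_pos hx0, Real.exp_le_exp, ← hvdef, ← hLdef]
    have : c₀ + Real.log v + (A + K) * v ≤ Real.exp v / 4 := h8
    rw [hLv] at this
    linarith
  -- C10
  have h10' : (Real.exp c₀ * v) ^ a ≤ L := by rw [← hLv]; exact h10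
  exact ⟨hx3, hL, hv2, hz₁, hz₁D, hx8', h7, h8', h10'⟩


/-! ### Numerics -/

/-- The exponents: `e^{-log D/log z₁} = e^{-v²/4}` and `e^{-t log√x/log z₀} = L^{-(K+1)}`
(`L = log x`, `v = log L`, `D = x^{1/4}`, `z₁ = exp(L/v²)`, `z₀ = x^{1/v}`, `t = 2(K+1)`). [folklore] -/
theorem exponents_eq {x K : ℝ} (hx : 1 < x) (hv : 0 < Real.log (Real.log x)) :
    Real.exp (-(Real.log (x ^ (1 / 4 : ℝ)) /
        Real.log (Real.exp (Real.log x / Real.log (Real.log x) ^ 2)))) =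
      Real.exp (-(Real.log (Real.log x) ^ 2 / 4)) ∧
    Real.exp (-((2 * (K + 1)) * (Real.log (Real.sqrt x) / Real.log (x ^ (1 / Real.log (Real.log x))))))
      = (Real.log x ^ (K + 1))⁻¹ := by
  have hx0 : 0 < x := by linarith
  have hL0 : 0 < Real.log x := Real.log_pos hx
  set L := Real.log x with hL
  set v := Real.log L with hvdef
  constructor
  · rw [Real.log_rpow hx0, Real.log_exp, ← hL]
    congr 1
    field_simp
  · rw [Real.log_sqrt hx0.le, Real.log_rpow hx0, ← hL]
    have e1 : 2 * (K + 1) * (L / 2 / (1 / v * L)) = (K + 1) * v := by field_simp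
    rw [e1, Real.rpow_def_of_pos hL0, ← Real.exp_neg, ← hvdef]
    congr 1; ring

/-- **The final numerics**: under `Conditions`, the structural bound is `≤ C' x/(log x)^K` with
`C' = C + 2 + C₁ 8^{K+A+3} e^{c₀} + 1`. [folklore] -/
theorem final_numerics {A K C C₁ x Pr Prt : ℝ} {q : ℕ} (hC : 0 ≤ C) (hC₁ : 0 ≤ C₁)
    (hc : Conditions A K (2 * Real.exp (2 * (K + 1)) - 1) x)
    (hqA : (q : ℝ) ≤ Real.log x ^ A)
    (hPr : Pr ≤ Real.exp c₀ * Real.log (Real.log x))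
    (hPrt : Prt ≤ (Real.exp c₀ * Real.log (Real.log x)) ^ (2 * Real.exp (2 * (K + 1)) - 1)) :
    Pr * (C * x * Real.exp (-(Real.log (x ^ (1 / 4 : ℝ)) /
            Real.log (Real.exp (Real.log x / Real.log (Real.log x) ^ 2))))
          + 2 * q * x ^ (1 / 4 : ℝ) * Real.sqrt x
          + q * (C₁ * 8 ^ (K + A + 3) / Real.log x ^ (K + A + 3)) * x * (1 + Real.log (x ^ (1 / 4 : ℝ))))
      + Real.exp (-((2 * (K + 1)) * (Real.log (Real.sqrt x) / Real.log (x ^ (1 / Real.log (Real.log x))))))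
          * x * Prt
    ≤ (C + 2 + C₁ * 8 ^ (K + A + 3) * Real.exp c₀ + 1) * x / Real.log x ^ K := by
  obtain ⟨hx3, hL64, hv2, -, -, -, h7, h8, h10⟩ := hc
  have hx1 : 1 < x := by linarith
  have hx0 : 0 < x := by linarith
  set L := Real.log x with hLdef
  set v := Real.log L with hvdef
  have hL0 : 0 < L := by linarith
  have hL1 : 1 ≤ L := by linarith
  have hv0 : 0 < v := by linarith
  obtain ⟨e1, e2⟩ := exponents_eq (K := K) hx1 hv0
  rw [e1, e2]
  set ι := x / L ^ K with hι
  have hLK : 0 < L ^ K := Real.rpow_pos_of_pos hL0 K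
  have hι0 : 0 < ι := by positivity
  have hq0 : (0 : ℝ) ≤ q := Nat.cast_nonneg q
  have hev : 0 < Real.exp c₀ * v := by positivity
  -- T1
  have hT1 : Pr * (C * x * Real.exp (-(v ^ 2 / 4))) ≤ C * ι := by
    calc Pr * (C * x * Real.exp (-(v ^ 2 / 4))) ≤ (Real.exp c₀ * v) * (C * x * Real.exp (-(v ^ 2 / 4))) :=
          mul_le_mul_of_nonneg_right hPr (by positivity)
      _ = (Real.exp c₀ * v * Real.exp (-(v ^ 2 / 4))) * (C * x) := by ring
      _ ≤ (L ^ K)⁻¹ * (C * x) := mul_le_mul_of_nonneg_right h7 (by positivity)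
      _ = C * ι := by rw [hι]; field_simp
  -- T2
  have hx34 : x ^ (1 / 4 : ℝ) * Real.sqrt x = x ^ (3 / 4 : ℝ) := by
    rw [Real.sqrt_eq_rpow, ← Real.rpow_add hx0]; norm_num
  have hx14 : x ^ (1 / 4 : ℝ) * x ^ (3 / 4 : ℝ) = x := by
    rw [← Real.rpow_add hx0]; norm_num
  have hLAK : L ^ (A + K) = L ^ A * L ^ K := Real.rpow_add hL0 A K
  have hT2 : Pr * (2 * q * x ^ (1 / 4 : ℝ) * Real.sqrt x) ≤ 2 * ι := by
    have h1 : Pr * q ≤ x ^ (1 / 4 : ℝ) / L ^ K := by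
      rw [le_div_iff₀ hLK]
      calc Pr * q * L ^ K ≤ (Real.exp c₀ * v) * L ^ A * L ^ K := by gcongr
        _ = Real.exp c₀ * v * L ^ (A + K) := by rw [hLAK]; ring
        _ ≤ x ^ (1 / 4 : ℝ) := h8
    calc Pr * (2 * q * x ^ (1 / 4 : ℝ) * Real.sqrt x) = 2 * (Pr * q) * x ^ (3 / 4 : ℝ) := by
          rw [← hx34]; ring
      _ ≤ 2 * (x ^ (1 / 4 : ℝ) / L ^ K) * x ^ (3 / 4 : ℝ) := by gcongr
      _ = 2 * (x ^ (1 / 4 : ℝ) * x ^ (3 / 4 : ℝ)) / L ^ K := by ring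
      _ = 2 * ι := by rw [hx14, hι]; ring
  -- T3
  have hT3 : Pr * (q * (C₁ * 8 ^ (K + A + 3) / L ^ (K + A + 3)) * x * (1 + Real.log (x ^ (1 / 4 : ℝ))))
      ≤ C₁ * 8 ^ (K + A + 3) * Real.exp c₀ * ι := by
    rw [Real.log_rpow hx0, ← hLdef]
    have hlogL : v ≤ L := (Real.log_le_sub_one_of_pos hL0).trans (by linarith)
    have h1 : v * (1 + 1 / 4 * L) ≤ L ^ 2 := by nlinarith
    have hB : L ^ (K + A + 3) = L ^ A * L ^ K * L ^ (3 : ℝ) := by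
      rw [← Real.rpow_add hL0, ← Real.rpow_add hL0]; ring_nf
    have hL3 : L ^ (3 : ℝ) = L ^ 2 * L := by
      rw [show (3 : ℝ) = (3 : ℕ) by norm_num, Real.rpow_natCast]; ring
    have hpos : 0 < L ^ (K + A + 3) := Real.rpow_pos_of_pos hL0 _
    calc Pr * (q * (C₁ * 8 ^ (K + A + 3) / L ^ (K + A + 3)) * x * (1 + 1 / 4 * L))
        ≤ (Real.exp c₀ * v) * (L ^ A * (C₁ * 8 ^ (K + A + 3) / L ^ (K + A + 3)) * x * (1 + 1 / 4 * L)) := by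
          gcongr
      _ = C₁ * 8 ^ (K + A + 3) * Real.exp c₀ * x * (v * (1 + 1 / 4 * L)) * L ^ A / L ^ (K + A + 3) := by
          field_simp
      _ ≤ C₁ * 8 ^ (K + A + 3) * Real.exp c₀ * x * L ^ 2 * L ^ A / L ^ (K + A + 3) := by
          gcongr
      _ = C₁ * 8 ^ (K + A + 3) * Real.exp c₀ * ι * (1 / L) := by
          rw [hB, hL3, hι]; field_simp
      _ ≤ C₁ * 8 ^ (K + A + 3) * Real.exp c₀ * ι * 1 := by
          refine mul_le_mul_of_nonneg_left ?_ (by positivity)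
          rw [div_le_one hL0]; exact hL1
      _ = _ := mul_one _
  -- T4
  have hT4 : (L ^ (K + 1))⁻¹ * x * Prt ≤ ι := by
    have hK1 : L ^ (K + 1) = L ^ K * L := by rw [Real.rpow_add hL0, Real.rpow_one]
    calc (L ^ (K + 1))⁻¹ * x * Prt ≤ (L ^ (K + 1))⁻¹ * x * L := by
          exact mul_le_mul_of_nonneg_left (hPrt.trans h10) (by positivity)
      _ = ι := by rw [hK1, hι]; field_simp
  have htot : Pr * (C * x * Real.exp (-(v ^ 2 / 4)) + 2 * q * x ^ (1 / 4 : ℝ) * Real.sqrt x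
      + q * (C₁ * 8 ^ (K + A + 3) / L ^ (K + A + 3)) * x * (1 + Real.log (x ^ (1 / 4 : ℝ))))
      + (L ^ (K + 1))⁻¹ * x * Prt ≤ (C + 2 + C₁ * 8 ^ (K + A + 3) * Real.exp c₀ + 1) * ι := by
    have : Pr * (C * x * Real.exp (-(v ^ 2 / 4)) + 2 * q * x ^ (1 / 4 : ℝ) * Real.sqrt x
        + q * (C₁ * 8 ^ (K + A + 3) / L ^ (K + A + 3)) * x * (1 + Real.log (x ^ (1 / 4 : ℝ))))
        = Pr * (C * x * Real.exp (-(v ^ 2 / 4))) + Pr * (2 * q * x ^ (1 / 4 : ℝ) * Real.sqrt x)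
          + Pr * (q * (C₁ * 8 ^ (K + A + 3) / L ^ (K + A + 3)) * x * (1 + Real.log (x ^ (1 / 4 : ℝ)))) := by
      ring
    rw [this]
    linarith
  refine htot.trans (le_of_eq ?_)
  rw [hι]; ring

/-! ### Lemma 4.8 -/

/-- **Lichtman 2020, Lemma 4.8, proved from Siegel–Walfisz for `μ`**: the named fact
`Lichtman2020_liouvilleCharacterSifted` follows from the named fact `SiegelWalfiszMoebius` (through
`SiegelWalfiszMoebius.liouville_progression`) and the fundamental lemma (through
`exists_sifted_sum_bound`), by the variant of the printed argument described in the module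
docstring (small primes by the sieve, large primes by Legendre's identity and an exponential moment).
[cite: Lichtman2020, Lemma 4.8] -/
theorem _root_.Literature.NumberTheory.Sieve.Lichtman2020_liouvilleCharacterSifted_of_siegelWalfiszMoebius
    (hSWμ : Literature.NumberTheory.LFunctions.SiegelWalfiszMoebius) :
    Lichtman2020_liouvilleCharacterSifted := by
  intro A K hA hK
  obtain ⟨C, hC, hFL⟩ := exists_sifted_sum_bound
  obtain ⟨C₁, hC₁⟩ := hSWμ.liouville_progression (A := 2 * A) (by positivity) (K + A + 3)
  -- `C₁ ≥ 0` without loss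
  have hSW : ∀ y : ℝ, 2 ≤ y → ∀ q : ℕ, 1 ≤ q → (q : ℝ) ≤ Real.log y ^ (2 * A) → ∀ a : ZMod q,
      |∑ n ∈ (Icc 1 ⌊y⌋₊).filter (fun n : ℕ => (n : ZMod q) = a), (liouville n : ℝ)| ≤
        max C₁ 0 * y / Real.log y ^ (K + A + 3) := by
    intro y hy q hq hqA a
    refine (hC₁ y hy q hq hqA a).trans ?_
    have hpow : 0 < Real.log y ^ (K + A + 3) := Real.rpow_pos_of_pos (Real.log_pos (by linarith)) _
    rw [div_le_div_iff_of_pos_right hpow]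
    exact mul_le_mul_of_nonneg_right (le_max_left _ _) (by linarith)
  set a := 2 * Real.exp (2 * (K + 1)) - 1 with hadef
  have ha : 0 ≤ a := by have := Real.add_one_le_exp (2 * (K + 1)); rw [hadef]; nlinarith
  obtain ⟨x₀, hx₀⟩ := Filter.eventually_atTop.1 (eventually_conditions A K a hA hK ha)
  set Cmain := C + 2 + max C₁ 0 * 8 ^ (K + A + 3) * Real.exp c₀ + 1 with hCmain
  have hCmain0 : 0 ≤ Cmain := by have := le_max_right C₁ 0; positivity
  refine ⟨max Cmain (Literature.NumberTheory.LFunctions.SiegelWalfiszLiouville.smallRangeConst x₀ K),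
    fun x hx q hq hqA χ Ps hPs => ?_⟩
  have hx0 : 0 < x := by linarith
  have hpowK : 0 < Real.log x ^ K := Real.rpow_pos_of_pos (Real.log_pos (by linarith)) K
  -- the trivial bound
  have htriv : ‖∑ m ∈ (Icc 1 ⌊x⌋₊).filter (fun m => ∀ p ∈ Ps, ¬ p ∣ m),
      ((liouville m : ℤ) : ℂ) * χ (m : ZMod q)‖ ≤ x := by
    have hIcc : Icc 1 ⌊x⌋₊ = Ioc 0 ⌊x⌋₊ := rfl
    rw [hIcc]
    exact (norm_sifted_sum_le_self χ _ _).trans (Nat.floor_le hx0.le)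
  rcases le_or_gt x₀ x with hxx₀ | hxx₀
  · have hc := hx₀ x hxx₀
    have hx1 : 1 < x := by linarith
    set L := Real.log x with hLdef
    set v := Real.log L with hvdef
    have hL0 : 0 < L := by linarith [hc.hL]
    have hv0 : 0 < v := by linarith [hc.hv]
    set z₀ := x ^ (1 / Real.log (Real.log x)) with hz₀def
    set z₁ := Real.exp (Real.log x / Real.log (Real.log x) ^ 2) with hz₁def
    have hz₀1 : 1 < z₀ := Real.one_lt_rpow hx1 (by rw [← hLdef, ← hvdef]; positivity)
    have hPs' : ∀ p ∈ Ps, p.Prime ∧ q < p ∧ (p : ℝ) < z₀ := fun p hp =>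
      ⟨(hPs p hp).1, by exact_mod_cast (hPs p hp).2.1, (hPs p hp).2.2⟩
    -- the level condition `D(M₀+1) ≤ √x − 2`, with `u = x^{1/8} ≥ 3`
    have hDM : x ^ (1 / 4 : ℝ) * ((⌈x ^ (1 / 8 : ℝ)⌉₊ : ℕ) + 1) ≤ Real.sqrt x - 2 := by
      set u := x ^ (1 / 8 : ℝ) with hu
      have hu3 : 3 ≤ u := hc.hx8
      have hD : x ^ (1 / 4 : ℝ) = u ^ 2 := by
        rw [hu, ← Real.rpow_natCast, ← Real.rpow_mul hx0.le]; norm_num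
      have hsq : Real.sqrt x = u ^ 4 := by
        rw [Real.sqrt_eq_rpow, hu, ← Real.rpow_natCast, ← Real.rpow_mul hx0.le]; norm_num
      have hceil : ((⌈u⌉₊ : ℕ) : ℝ) ≤ u + 1 := (Nat.ceil_lt_add_one (by linarith)).le
      rw [hD, hsq]
      have h1 : u + 3 ≤ u ^ 2 := by nlinarith
      have h2 : u ^ 2 * (u + 3) ≤ u ^ 2 * u ^ 2 := mul_le_mul_of_nonneg_left h1 (sq_nonneg u)
      calc u ^ 2 * ((⌈u⌉₊ : ℕ) + 1) ≤ u ^ 2 * (u + 2) := by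
            refine mul_le_mul_of_nonneg_left (by linarith) (by positivity)
        _ ≤ u ^ 4 - 2 := by nlinarith
    have hε : 0 ≤ max C₁ 0 * 8 ^ (K + A + 3) / Real.log x ^ (K + A + 3) := by
      have := le_max_right C₁ 0; positivity
    have hΛ := fun c M hM => progression_bound (B' := K + A + 3) hA (by positivity) (le_max_right C₁ 0)
      hSW hx1 hc.hL (le_trans (by norm_num) hc.hx8) hq hqA c M hM
    have key := structural_bound hC hFL (x := x) (z₀ := z₀) (z₁ := z₁) (D := x ^ (1 / 4 : ℝ))
      (ε := max C₁ 0 * 8 ^ (K + A + 3) / Real.log x ^ (K + A + 3)) (t := 2 * (K + 1))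
      (M₀ := ⌈x ^ (1 / 8 : ℝ)⌉₊) hq χ hPs' hx1.le hz₀1 hc.hz₁ hc.hz₁D hε (by positivity) hDM hΛ
    -- the products over the large primes
    have hPlp : ∀ p ∈ Ps.filter (fun p : ℕ => z₁ ≤ (p : ℝ)), p.Prime := fun p hp =>
      (hPs p (Finset.mem_filter.1 hp).1).1
    have hlo : ∀ p ∈ Ps.filter (fun p : ℕ => z₁ ≤ (p : ℝ)), z₁ ≤ (p : ℝ) := fun p hp =>
      (Finset.mem_filter.1 hp).2
    have hhi : ∀ p ∈ Ps.filter (fun p : ℕ => z₁ ≤ (p : ℝ)), (p : ℝ) < z₀ := fun p hp =>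
      (hPs p (Finset.mem_filter.1 hp).1).2.2
    have hv1 : 1 ≤ Real.log (Real.log x) := by linarith [hc.hv]
    have hPr := prod_le_loglog_pow hPlp hx1 hv1 hc.hz₁ hlo hhi zero_le_one
    rw [Real.rpow_one] at hPr
    have hPrt := prod_le_loglog_pow hPlp hx1 hv1 hc.hz₁ hlo hhi ha
    have hnum := final_numerics (q := q) (C := C) hC.le (le_max_right C₁ 0) hc hqA hPr hPrt
    calc _ ≤ _ := key
      _ ≤ Cmain * x / Real.log x ^ K := hnum
      _ ≤ max Cmain _ * x / Real.log x ^ K := by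
          rw [div_le_div_iff_of_pos_right hpowK]
          exact mul_le_mul_of_nonneg_right (le_max_left _ _) hx0.le
  · refine (Literature.NumberTheory.LFunctions.SiegelWalfiszLiouville.le_smallRangeConst_mul
      (by linarith) hxx₀.le htriv (B := K)).trans ?_
    rw [div_le_div_iff_of_pos_right hpowK]
    exact mul_le_mul_of_nonneg_right (le_max_right _ _) hx0.le

end LiouvilleSifted

end Literature.NumberTheory.Sieve
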